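import Summits.BirchSwinnertonDyer.BirchSwinnertonDyer.Theorems.SylvesterTwoHeegnerIndexCoupledDescentCebotarevKummerImage
import Literature.NumberTheory.EllipticCurves.SelmerTorsionCMOperatorJZero
import Literature.NumberTheory.EllipticCurves.ShaRestrictionJZeroDescent
import HarnessLib

/-!
# The bottom class of VARIANT K's leaf (L1) does not depend on the chosen non-divisible point

Crux `UpperOffV0HSYPlus` (stmt-BirchSwinnertonDyer-19804), leaf (L1) of THEOREM K2's deduction
`selmerGroup_eq_bot_and_le_closure_of_coupledLeaves` (p620148).  The only place where (L1) — the
coupled Kolyvagin classes `c_A(ℓ)`, `c_B(ℓℓ′)` with their two FLIP criteria — mentions the bottom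
point `Y ∈ E_p(K)` is the FLIP criterion at `λ ∋ ℓ`: `c_A(ℓ) ∈ S_A(λ) ↔ δY ∈ T_B(λ)`, i.e. through the
local TRIVIALITY of the Kummer class `δY` at `λ`.  The rows' natural bottom point is the transport of
the `χ_B`-component `P₁^{χ_B}` of HSY's CM point (memo two §57.3: «`c_{B,M}(1) = δ(uY)`, `u` odd»),
while the height display of `PublishedFactsTwoPlus` / of `…FirstLayerOfL1` speaks of ITS point `Y`.

THIS FILE proves that the criterion is the same for ALL non-`2`-divisible `Y ∈ E_p(K)` when
`rank_ℤ E_p(K) = 2`: by `…CebotarevKummerImage` the image `M = δ(E_p(K))` is ONE `𝔽₄`-line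
`{0, y, wy, y + wy}` generated by any `y = δY ≠ 0` (`w = H¹([ζ])`), and the local kernel
`T_B(v) = ker (H¹(K, E_p[2]) → H¹(K_v, E_p[2]))` is a `w`-stable subgroup (`resH1Hom_id_mem_torsionLocalKer`,
generic: `H¹(fn)` respects the local kernel when `fn` lies under a map with local points maps), so
`δY₁ ∈ T_B(v) ↔ δY₂ ∈ T_B(v)` (`kummerClassOfPoint_mem_torsionLocalKer_iff`), and (L1) for `δY₁`
is (L1) for `δY₂` (`hL1_of_hL1`).  Consequence for the rows: build (L1) ONCE for the CM bottom point,
and combine it with ANY display point via the single scalar input «both points are not `2`-divisible».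
Theorem-only; nothing asserted on 19804; no label moves; BSD not claimed for any curve.
-/

set_option linter.dupNamespace false -- Summits modules are `Summit.<Summit>.<Problem>…` by design

noncomputable section

open scoped Classical
open WeierstrassCurve NumberField IsDedekindDomain Field
open Literature.NumberTheory.EllipticCurves Literature.NumberTheory.GaloisRepresentations
open Literature.NumberTheory.EllipticCurves.HuShuYin2019

namespace Summit.BirchSwinnertonDyer.BirchSwinnertonDyer.Theorems.SylvesterTwoCoupledDescentCebotarev

universe u

/-! ## `H¹(fn)` respects the local kernel `ker (H¹(K, E[n]) → H¹(K_v, E[n]))` -/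

section TorsionLocalKer

variable {K : Type u} [Field K] (W : WeierstrassCurve K) (n : ℤ) (E : Type u) [Field E] [Algebra K E]

/-- **`H¹(fn) (T(v)) ⊆ T(v)`** for the local kernel `T(v) = ker (H¹(K, E[n]) → H¹(E, E(K̄_E)[n]))`
(`torsionLocalKer`), when `fn : E[n] → E[n]` lies under an additive `f` on `E(K̄)` having a local points
map `fE` at `E` (`fE ∘ ι = ι ∘ f`, `fE` equivariant — every isogeny): both paths
`H¹(K, E[n]) → H¹(E, E(K̄_E)[n])` are the map of one compatible pair (as in k-ty1's
`resH1Hom_id_mem_selmerLocalKer`). Milne, *ADT*, I.§6. [cite: MilneADT2006, Ch. I §6 p. 75] -/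
theorem resH1Hom_id_mem_torsionLocalKer (fn : geomTorsion W n →+ geomTorsion W n)
    (hfn : ∀ (σ : Field.absoluteGaloisGroup K) (P : geomTorsion W n),
      fn (ContinuousMonoidHom.id _ σ • P) = σ • fn P)
    (f : W.geomPoints →+ W.geomPoints)
    (hcoe : ∀ P : geomTorsion W n, ((fn P : geomTorsion W n) : W.geomPoints) = f P)
    (fE : localPoints W E →+ localPoints W E)
    (hfE : ∀ (τ : Field.absoluteGaloisGroup E) (P : localPoints W E), fE (τ • P) = τ • fE P)
    (hcomp : ∀ P : W.geomPoints, fE (pointsMap W E P) = pointsMap W E (f P))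
    {c : galH1Torsion W n} (hc : c ∈ W.torsionLocalKer E n) :
    resH1Hom (ContinuousMonoidHom.id _) fn hfn c ∈ W.torsionLocalKer E n := by
  -- the local counterpart of `fn`: `fE` restricted to `E(K̄_E)[n]`
  let fEn : AddSubgroup.torsionBy (localPoints W E) n →+ AddSubgroup.torsionBy (localPoints W E) n :=
    (fE.comp (AddSubgroup.torsionBy (localPoints W E) n).subtype).codRestrict _ fun P ↦ by
      change fE (P : localPoints W E) ∈ AddSubgroup.torsionBy (localPoints W E) n
      have hP : n • (P : localPoints W E) = 0 := (Submodule.mem_torsionBy_iff _ _).mp P.2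
      exact (Submodule.mem_torsionBy_iff _ _).mpr (by rw [← map_zsmul, hP, map_zero])
  have hfEn : ∀ (τ : Field.absoluteGaloisGroup E) (P : AddSubgroup.torsionBy (localPoints W E) n),
      fEn (ContinuousMonoidHom.id _ τ • P) = τ • fEn P := fun τ P ↦ by
    apply Subtype.ext
    change fE ((τ • P : AddSubgroup.torsionBy (localPoints W E) n) : localPoints W E) =
      ((τ • fEn P : AddSubgroup.torsionBy (localPoints W E) n) : localPoints W E)
    rw [Literature.NumberTheory.EllipticCurves.AddSubgroup.torsionBy.coe_smul,
      Literature.NumberTheory.EllipticCurves.AddSubgroup.torsionBy.coe_smul, hfE]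
    rfl
  unfold WeierstrassCurve.torsionLocalKer at hc ⊢
  rw [resKer_eq_ker, AddMonoidHom.mem_ker] at hc ⊢
  have key : (resH1Hom (resGal (K := K) E) (torsionPointsMap W E n)
      (torsionPointsMap_smul W E n)).comp (resH1Hom (ContinuousMonoidHom.id _) fn hfn) =
      (resH1Hom (ContinuousMonoidHom.id (Field.absoluteGaloisGroup E)) fEn hfEn).comp
        (resH1Hom (resGal (K := K) E) (torsionPointsMap W E n) (torsionPointsMap_smul W E n)) := by
    rw [resH1Hom_comp, resH1Hom_comp]
    refine resH1Hom_congr (by ext; rfl) ?_ _ _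
    ext P
    change (pointsMap W E ((fn P : geomTorsion W n) : W.geomPoints) : localPoints W E) =
      fE (pointsMap W E (P : W.geomPoints))
    rw [hcoe, hcomp]
  have hkey := congrArg (fun F : galH1Torsion W n →+ _ ↦ F c) key
  simp only [AddMonoidHom.comp_apply] at hkey
  rw [hkey, hc, map_zero]

end TorsionLocalKer

/-! ## The bottom class: any two non-divisible points of `E_p(K)` are interchangeable -/

section BottomClass

variable {K : Type} [Field K] [NumberField K] {ω : K} (hω : ω ^ 2 + ω + 1 = 0)
  (h2 : Module.finrank ℚ K = 2) {p : ℕ} (hp : p.Prime) (hp2 : p ≠ 2)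
  (hrank : ((cubeSumCurve (p : ℚ)).baseChange K).mordellWeilRank = 2)

include hω h2 hp hp2 hrank in
/-- **`δY₁ ∈ T_B(v) ↔ δY₂ ∈ T_B(v)` for any two non-`2`-divisible `Y₁, Y₂ ∈ E_p(K)`** (`K ∋ ω`
quadratic, `rank_ℤ E_p(K) = 2`) and every `K`-field `E` (every completion `K_v`): both classes generate
the one `𝔽₄`-line `δ(E_p(K))` (`#δ(E_p(K)) = 4`, `exists_eq_line_of_natCard_le_four`) and `T_B` is an
`H¹([ζ])`-stable subgroup (`resH1Hom_id_mem_torsionLocalKer`). [folklore] -/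
theorem kummerClassOfPoint_mem_torsionLocalKer_iff (E : Type) [Field E] [Algebra K E]
    (Y₁ Y₂ : ((cubeSumCurve (p : ℚ)).baseChange K).toAffine.Point)
    (hY₁ : ¬ ∃ Q : ((cubeSumCurve (p : ℚ)).baseChange K).toAffine.Point, (2 : ℕ) • Q = Y₁)
    (hY₂ : ¬ ∃ Q : ((cubeSumCurve (p : ℚ)).baseChange K).toAffine.Point, (2 : ℕ) • Q = Y₂) :
    kummerClassOfPoint (cubeSumCurve (p : ℚ)) K Nat.prime_two Y₁ ∈
        ((cubeSumCurve (p : ℚ)).baseChange K).torsionLocalKer E ((2 : ℕ) : ℤ) ↔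
      kummerClassOfPoint (cubeSumCurve (p : ℚ)) K Nat.prime_two Y₂ ∈
        ((cubeSumCurve (p : ℚ)).baseChange K).torsionLocalKer E ((2 : ℕ) : ℤ) := by
  have hp0 : (p : ℚ) ≠ 0 := by exact_mod_cast hp.ne_zero
  haveI := Rank1Residual.X12.CubeSumFamilies.isElliptic_cubeSumCurve hp0
  haveI hBK : ((cubeSumCurve (p : ℚ)).baseChange K).IsElliptic :=
    inferInstanceAs ((cubeSumCurve (p : ℚ)).map (algebraMap ℚ K)).IsElliptic
  -- the `[ζ]`-isogeny `φ` of `E_p ⁄ K`, its restriction `fn` to `E_p[2]`, `w = H¹(fn)`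
  have hXeq : (cubeSumCurve (p : ℚ)).baseChange K = ⟨0, 0, 0, 0, algebraMap ℚ K (-432 * (p : ℚ) ^ 2)⟩ := by
    ext <;> first | rfl | (change algebraMap ℚ K 0 = 0; rw [map_zero])
  obtain ⟨φ, hφ, hrel⟩ := JZero.exists_cm_isogeny_of_eq (V := (cubeSumCurve (p : ℚ)).baseChange K)
    hXeq (JZero.exists_aut_apply_eq_sq K hω h2).1
  let fn : geomTorsion ((cubeSumCurve (p : ℚ)).baseChange K) ((2 : ℕ) : ℤ) →+
      geomTorsion ((cubeSumCurve (p : ℚ)).baseChange K) ((2 : ℕ) : ℤ) :=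
    (φ.toAddMonoidHom.comp (geomTorsion _ ((2 : ℕ) : ℤ)).subtype).codRestrict _ fun P ↦ by
      simp only [AddMonoidHom.coe_comp, AddSubgroup.coe_subtype, Function.comp_apply]
      rw [mem_geomTorsion_iff, ← map_zsmul, (mem_geomTorsion_iff _ _ _).mp P.2, map_zero]
  have hcoe : ∀ P : geomTorsion ((cubeSumCurve (p : ℚ)).baseChange K) ((2 : ℕ) : ℤ),
      ((fn P : geomTorsion _ ((2 : ℕ) : ℤ)) : geomPoints ((cubeSumCurve (p : ℚ)).baseChange K)) =
        φ P := fun _ ↦ rfl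
  have hfn : ∀ (g : absoluteGaloisGroup K)
      (P : geomTorsion ((cubeSumCurve (p : ℚ)).baseChange K) ((2 : ℕ) : ℤ)),
      fn (ContinuousMonoidHom.id _ g • P) = g • fn P := by
    intro g P
    apply Subtype.ext
    rw [hcoe, AddSubgroup.torsionBy.coe_smul, AddSubgroup.torsionBy.coe_smul, hcoe]
    exact φ.equivariant g P
  set w := resH1Hom (ContinuousMonoidHom.id _) fn hfn with hw_def
  have hreln : ∀ P : geomTorsion ((cubeSumCurve (p : ℚ)).baseChange K) ((2 : ℕ) : ℤ),
      fn (fn P) + fn P + P = 0 := by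
    intro P
    apply Subtype.ext
    change ((fn (fn P) : geomTorsion _ _) : geomPoints ((cubeSumCurve (p : ℚ)).baseChange K)) +
      ((fn P : geomTorsion _ _) : geomPoints ((cubeSumCurve (p : ℚ)).baseChange K)) +
      (P : geomPoints ((cubeSumCurve (p : ℚ)).baseChange K)) = 0
    exact hrel P
  have hw : ∀ x, w (w x) + w x + x = 0 := resH1Hom_id_apply_apply_add _ fn hfn hreln
  -- `w` preserves the local kernel (local points map of the isogeny)
  have hwT : ∀ {c}, c ∈ ((cubeSumCurve (p : ℚ)).baseChange K).torsionLocalKer E ((2 : ℕ) : ℤ) →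
      w c ∈ ((cubeSumCurve (p : ℚ)).baseChange K).torsionLocalKer E ((2 : ℕ) : ℤ) := by
    intro c hc
    obtain ⟨fE, hfE, hcomp⟩ := φ.hasLocalPointsMaps_toAddMonoidHom E
    exact resH1Hom_id_mem_torsionLocalKer _ _ E fn hfn φ.toAddMonoidHom hcoe fE hfE hcomp hc
  -- the image of `δ`: both classes, their `w`-images; `#M = 4`
  obtain ⟨hdiv, hκ⟩ : ∃ hdiv, ∀ Y, kummerClassOfPoint (cubeSumCurve (p : ℚ)) K Nat.prime_two Y =
      kummerMapTorsion ((cubeSumCurve (p : ℚ)).baseChange K) ((2 : ℕ) : ℤ) hdiv Y := ⟨_, fun _ ↦ rfl⟩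
  set κ := kummerMapTorsion ((cubeSumCurve (p : ℚ)).baseChange K) ((2 : ℕ) : ℤ) hdiv with hκ_def
  have hM : Nat.card κ.range = 4 := natCard_range_kummerMapTorsion_cubeSumCurve hω h2 hp hp2 hrank hdiv
  haveI : Finite κ.range := Nat.finite_of_card_ne_zero (by rw [hM]; norm_num)
  have hwM : ∀ Y, w (κ Y) ∈ κ.range := fun Y ↦ by
    obtain ⟨Y', hY'⟩ := exists_toGeomPoints_eq_apply hω hp φ.toAddMonoidHom hφ Y
    exact ⟨Y', (resH1Hom_id_kummerMapTorsion _ _ φ.toAddMonoidHom φ.equivariant fn hfn hcoe hdiv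
      Y Y' hY').symm⟩
  -- each class lies on the line of the other
  have hline : ∀ {Y Y' : ((cubeSumCurve (p : ℚ)).baseChange K).toAffine.Point},
      (¬ ∃ Q : ((cubeSumCurve (p : ℚ)).baseChange K).toAffine.Point, (2 : ℕ) • Q = Y) →
      ∃ a b : ℤ, κ Y' = a • κ Y + b • w (κ Y) := by
    intro Y Y' hY
    have hy0 : κ Y ≠ 0 := by rw [← hκ]; exact kummerClassOfPoint_ne_zero _ _ _ hY
    have hy2 : (2 : ℤ) • κ Y = 0 := by rw [← hκ]; exact two_zsmul_galH1Torsion_two _ _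
    exact exists_eq_line_of_natCard_le_four w hw κ.range hM.le hy0 hy2 ⟨Y, rfl⟩ (hwM Y) ⟨Y', rfl⟩
  -- membership in the `w`-stable subgroup `T` along the line
  have key : ∀ {Y Y' : ((cubeSumCurve (p : ℚ)).baseChange K).toAffine.Point},
      (¬ ∃ Q : ((cubeSumCurve (p : ℚ)).baseChange K).toAffine.Point, (2 : ℕ) • Q = Y) →
      κ Y ∈ ((cubeSumCurve (p : ℚ)).baseChange K).torsionLocalKer E ((2 : ℕ) : ℤ) →
      κ Y' ∈ ((cubeSumCurve (p : ℚ)).baseChange K).torsionLocalKer E ((2 : ℕ) : ℤ) := by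
    intro Y Y' hY hT
    obtain ⟨a, b, hab⟩ := hline (Y' := Y') hY
    rw [hab]
    exact AddSubgroup.add_mem _ (AddSubgroup.zsmul_mem _ hT a) (AddSubgroup.zsmul_mem _ (hwT hT) b)
  rw [hκ, hκ]
  exact ⟨key hY₁, key hY₂⟩

include hω h2 hp hp2 hrank in
/-- **(L1) for `δY₁` ⇒ (L1) for `δY₂`** (any two non-`2`-divisible `Y₁, Y₂ ∈ E_p(K)`, `rank_ℤ E_p(K) = 2`):
the leaf (L1) of `selmerGroup_eq_bot_and_le_closure_of_coupledLeaves` at `p = 2` for the pair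
`(A, E_p)` — coupled classes `c_A(ℓ) ∈ H¹(K, A[2])`, `c_B(ℓℓ′) ∈ H¹(K, E_p[2])` Selmer off their level
with the two FLIP criteria — mentions the bottom point only through `δY ∈ T_B(v)`, which is the same
for `Y₁` and `Y₂` (`kummerClassOfPoint_mem_torsionLocalKer_iff`). Any `A : WeierstrassCurve ℚ`, any
Kolyvagin predicate `Kol`. -/
theorem hL1_of_hL1 (A : WeierstrassCurve ℚ) (Kol : ℕ → Prop)
    (Y₁ Y₂ : ((cubeSumCurve (p : ℚ)).baseChange K).toAffine.Point)
    (hY₁ : ¬ ∃ Q : ((cubeSumCurve (p : ℚ)).baseChange K).toAffine.Point, (2 : ℕ) • Q = Y₁)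
    (hY₂ : ¬ ∃ Q : ((cubeSumCurve (p : ℚ)).baseChange K).toAffine.Point, (2 : ℕ) • Q = Y₂)
    (hL1 : ∃ (cA : ℕ → galH1Torsion (A.baseChange K) (2 : ℕ))
        (cB : ℕ → galH1Torsion ((cubeSumCurve (p : ℚ)).baseChange K) (2 : ℕ)),
      (∀ ℓ, Kol ℓ →
        (∀ v : HeightOneSpectrum (𝓞 K), (ℓ : 𝓞 K) ∉ v.asIdeal →
          cA ℓ ∈ selmerLocalKer (A.baseChange K) (v.adicCompletion K) (2 : ℕ)) ∧
        (∀ x : InfinitePlace K, cA ℓ ∈ selmerLocalKer (A.baseChange K) x.Completion (2 : ℕ)) ∧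
        (∀ v : HeightOneSpectrum (𝓞 K), (ℓ : 𝓞 K) ∈ v.asIdeal →
          (cA ℓ ∈ selmerLocalKer (A.baseChange K) (v.adicCompletion K) (2 : ℕ) ↔
            kummerClassOfPoint (cubeSumCurve (p : ℚ)) K Nat.prime_two Y₁ ∈
              ((cubeSumCurve (p : ℚ)).baseChange K).torsionLocalKer (v.adicCompletion K) (2 : ℕ)))) ∧
      (∀ ℓ ℓ', Kol ℓ → Kol ℓ' → ℓ ≠ ℓ' →
        (∀ v : HeightOneSpectrum (𝓞 K), (ℓ : 𝓞 K) ∉ v.asIdeal → (ℓ' : 𝓞 K) ∉ v.asIdeal →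
          cB (ℓ * ℓ') ∈ selmerLocalKer ((cubeSumCurve (p : ℚ)).baseChange K)
            (v.adicCompletion K) (2 : ℕ)) ∧
        (∀ x : InfinitePlace K,
          cB (ℓ * ℓ') ∈ selmerLocalKer ((cubeSumCurve (p : ℚ)).baseChange K) x.Completion (2 : ℕ)) ∧
        (∀ v : HeightOneSpectrum (𝓞 K), (ℓ : 𝓞 K) ∈ v.asIdeal →
          (cB (ℓ * ℓ') ∈ selmerLocalKer ((cubeSumCurve (p : ℚ)).baseChange K)
              (v.adicCompletion K) (2 : ℕ) ↔
            cA ℓ' ∈ (A.baseChange K).torsionLocalKer (v.adicCompletion K) (2 : ℕ))))) :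
    ∃ (cA : ℕ → galH1Torsion (A.baseChange K) (2 : ℕ))
        (cB : ℕ → galH1Torsion ((cubeSumCurve (p : ℚ)).baseChange K) (2 : ℕ)),
      (∀ ℓ, Kol ℓ →
        (∀ v : HeightOneSpectrum (𝓞 K), (ℓ : 𝓞 K) ∉ v.asIdeal →
          cA ℓ ∈ selmerLocalKer (A.baseChange K) (v.adicCompletion K) (2 : ℕ)) ∧
        (∀ x : InfinitePlace K, cA ℓ ∈ selmerLocalKer (A.baseChange K) x.Completion (2 : ℕ)) ∧
        (∀ v : HeightOneSpectrum (𝓞 K), (ℓ : 𝓞 K) ∈ v.asIdeal →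
          (cA ℓ ∈ selmerLocalKer (A.baseChange K) (v.adicCompletion K) (2 : ℕ) ↔
            kummerClassOfPoint (cubeSumCurve (p : ℚ)) K Nat.prime_two Y₂ ∈
              ((cubeSumCurve (p : ℚ)).baseChange K).torsionLocalKer (v.adicCompletion K) (2 : ℕ)))) ∧
      (∀ ℓ ℓ', Kol ℓ → Kol ℓ' → ℓ ≠ ℓ' →
        (∀ v : HeightOneSpectrum (𝓞 K), (ℓ : 𝓞 K) ∉ v.asIdeal → (ℓ' : 𝓞 K) ∉ v.asIdeal →
          cB (ℓ * ℓ') ∈ selmerLocalKer ((cubeSumCurve (p : ℚ)).baseChange K)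
            (v.adicCompletion K) (2 : ℕ)) ∧
        (∀ x : InfinitePlace K,
          cB (ℓ * ℓ') ∈ selmerLocalKer ((cubeSumCurve (p : ℚ)).baseChange K) x.Completion (2 : ℕ)) ∧
        (∀ v : HeightOneSpectrum (𝓞 K), (ℓ : 𝓞 K) ∈ v.asIdeal →
          (cB (ℓ * ℓ') ∈ selmerLocalKer ((cubeSumCurve (p : ℚ)).baseChange K)
              (v.adicCompletion K) (2 : ℕ) ↔
            cA ℓ' ∈ (A.baseChange K).torsionLocalKer (v.adicCompletion K) (2 : ℕ)))) := by
  obtain ⟨cA, cB, h₁, h₂⟩ := hL1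
  refine ⟨cA, cB, fun ℓ hℓ ↦ ⟨(h₁ ℓ hℓ).1, (h₁ ℓ hℓ).2.1, fun v hv ↦ ?_⟩, h₂⟩
  rw [(h₁ ℓ hℓ).2.2 v hv]
  exact kummerClassOfPoint_mem_torsionLocalKer_iff hω h2 hp hp2 hrank (v.adicCompletion K) Y₁ Y₂ hY₁ hY₂

end BottomClass

end Summit.BirchSwinnertonDyer.BirchSwinnertonDyer.Theorems.SylvesterTwoCoupledDescentCebotarev

end
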